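import Summits.Schanuel.Schanuel.Theorems.RootDecomp1KHyper25

/-!
# RootDecomp1KHyper — lens 6, generation 15 «QUAD-ANCHORED CELL» (QuadAnchor.lean 33b3769e…, 2400 l) — continuation (RootDecomp1KHyper26): §6 genuinely ternary: planted vectors `hKvec`, `SmallFormsArePlanted`, plane lemma (`Edef`), reduction `not_hasHLPairInSpan_yQ_of`

(lens-6 g15 `QuadAnchor.lean`, sha256 33b3769e…6b415, farm rc 0 · 0 sorry · axioms standard; port by census-1 gen 14 in eight parts RootDecomp1KHyper20–27 at the section
cuts of CENSUS-REQUEST 2026-08-31T01:16:56Z (STATUS L1528; §5 cut at §5b; §3's three engine corollaries moved to where they are first used); each part imports the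
previous; statements and proofs verbatim (54 one-line docstrings added, six generic one-liners privatised with per-part private copies, the two `linter.*` options dropped, two unused binders renamed `_`); `hLW : LWMeasure` (tree-proved
named fact) stays a binder where marked; `--supports stmt-Schanuel-33363` (A₄ʰ HyperLiouvilleSchanuel, residual of record `Rank3SpanResidual`). Nothing here proves Schanuel; rung 0.)
-/

noncomputable section

open Complex IntermediateField Polynomial

namespace Summit.Schanuel.Schanuel.Theorems.RootDecomp1KHyper

namespace HyperCell
variable {n : ℕ}
open Summit.Schanuel.Schanuel.Theorems.RootDecomp1KGeneric (HasHLPairInSpan Rank3SpanResidual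
  mem_adjoin_of_mem_span cexp_mem_adjoin_of_mem_span)

/-- `(q : ℝ) · den q = num q`. -/
private theorem ratCast_mul_den (q : ℚ) : (q : ℝ) * q.den = q.num := by
  exact_mod_cast Rat.mul_den_eq_num q

/-- The form `−a − b√D + q y` evaluated on `(1, √D, y)`. -/
private theorem quadTriple_form (D : ℕ) (y : ℝ) (a b : ℤ) (q : ℕ) :
    ∑ i, ((![-a, -b, (q : ℤ)] : Fin 3 → ℤ) i : ℂ) * quadTriple D y i =
      (((q : ℝ) * y - (a : ℝ) - (b : ℝ) * Real.sqrt D : ℝ) : ℂ) := by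
  rw [Fin.sum_univ_three]
  simp only [quadTriple_zero, quadTriple_one, quadTriple_two, Matrix.cons_val_zero,
    Matrix.cons_val_one, Matrix.head_cons, Matrix.cons_val_two, Matrix.tail_cons]
  push_cast
  ring

/-! ## 6. The explicit member is GENUINELY TERNARY: no hyper-Liouville pair in its span

`HasHLPairInSpan z` (the n = 3 cell already decided in the tree, `sb_three_of_hlPairInSpan`) asks
for `v ≠ 0` and a hyper-Liouville REAL `ρ` with `v, ρ v ∈ span_ℤ(z)`.  For `z_Q = (1, √2, y_Q)` we
show this is impossible, in two layers:
* (6a, unconditional) the PLANE LEMMA: if the planted form `h_K = (−P_K, −M_K, 2^{a_K})` is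
  orthogonal to an integer vector `n` at ONE index `K ≥ |n₀| + |n₁| + 2`, then `n = 0` (the defects
  `E_K = n·h_K` obey `E_{K+1} = 2^{a_{K+1}−a_K} E_K − (n₀ or n₁ by parity)`, and `2^{a_{K+1}−a_K}`
  outgrows `n`); and the REDUCTION: an HL pair `(v, ρv)` with coefficient vectors `u, u'` yields, from
  every good rational approximation `p/q` of `ρ`, a non-zero integer form `p u − q u'` in the plane
  `u × u' = n ≠ 0` that is as small as we please relative to its height;
* (6b) LEMMA P `SmallFormsArePlanted`: every sufficiently small form of `z_Q` is an integer multiple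
  of a planted `h_K` — proved in §7 below from the lacunarity of `a_k` and Liouville's inequality in
  `ℚ(√2)`; §6 takes it as a named hypothesis so that the two layers are checkable separately. -/

/-- The planted forms `h_K = (−P_K, −M_K, 2^{a_K})`. -/
def hKvec (K : ℕ) : Fin 3 → ℤ := ![-((pmP K : ℕ) : ℤ), -((pmM K : ℕ) : ℤ), ((2 ^ hexp K : ℕ) : ℤ)]

/-- Coordinate `0` of the planted vector `h_K = (−P_K, −M_K, 2^{a_K})`. -/
@[simp] theorem hKvec_zero (K : ℕ) : hKvec K 0 = -((pmP K : ℕ) : ℤ) := rfl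
/-- Coordinate `1` of the planted vector `h_K = (−P_K, −M_K, 2^{a_K})`. -/
@[simp] theorem hKvec_one (K : ℕ) : hKvec K 1 = -((pmM K : ℕ) : ℤ) := rfl
/-- Coordinate `2` of the planted vector `h_K = (−P_K, −M_K, 2^{a_K})`. -/
@[simp] theorem hKvec_two (K : ℕ) : hKvec K 2 = ((2 ^ hexp K : ℕ) : ℤ) := rfl

/-- The planted vectors `h_K` are non-zero. -/
theorem hKvec_ne_zero (K : ℕ) : hKvec K ≠ 0 := by
  intro h
  have := congr_fun h 2
  rw [hKvec_two, Pi.zero_apply] at this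
  have h2 : (2 : ℕ) ^ hexp K ≠ 0 := pow_ne_zero _ (by norm_num)
  omega

/-- **LEMMA P (statement).**  Every sufficiently small integer form of `z_Q = (1, √2, y_Q)` is an
integer multiple of a planted form. -/
def SmallFormsArePlanted : Prop :=
  ∃ m₀ : ℕ, ∀ h : Fin 3 → ℤ, h ≠ 0 →
    ‖∑ i, (h i : ℂ) * quadTriple 2 yQ i‖ < Real.exp (-((1 + ∑ i, |(h i : ℝ)|) ^ m₀)) →
      ∃ (K : ℕ) (t : ℤ), h = t • hKvec K

/-- The planted form evaluates to `2^{a_K} · (tail after K+1 terms)`. -/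
theorem hKvec_form (K : ℕ) :
    ∑ i, (hKvec K i : ℂ) * quadTriple 2 yQ i =
      (((2 : ℝ) ^ hexp K * ∑' k, yterm (k + (K + 1)) : ℝ) : ℂ) := by
  have e : hKvec K = ![-((pmP K : ℕ) : ℤ), -((pmM K : ℕ) : ℤ), ((2 ^ hexp K : ℕ) : ℤ)] := rfl
  rw [e, quadTriple_form 2 yQ (pmP K) (pmM K) (2 ^ hexp K)]
  congr 1
  rw [yQ_eq_partialSum_add_tail (K + 1), partialSum_yterm K]
  have h2 : (0 : ℝ) < 2 ^ hexp K := by positivity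
  push_cast
  field_simp
  ring

/-- The planted form `h_K · z_Q` has norm `2^{a_K}` times the `(K+1)`-th tail of `Σ yterm`. -/
theorem norm_hKvec_form (K : ℕ) :
    ‖∑ i, (hKvec K i : ℂ) * quadTriple 2 yQ i‖ = (2 : ℝ) ^ hexp K * ∑' k, yterm (k + (K + 1)) := by
  rw [hKvec_form, Complex.norm_real, Real.norm_eq_abs,
    abs_of_pos (mul_pos (by positivity) (yQ_tail_pos _))]

/-- Lower bound `1 / 2^{a_{K+1}} ≤ ‖h_K · z_Q‖` for the planted forms. -/
theorem hKvec_form_lower (K : ℕ) :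
    1 / (2 : ℝ) ^ hexp (K + 1) ≤ ‖∑ i, (hKvec K i : ℂ) * quadTriple 2 yQ i‖ := by
  rw [norm_hKvec_form]
  calc 1 / (2 : ℝ) ^ hexp (K + 1) ≤ yterm (K + 1) := one_div_le_yterm _
    _ ≤ ∑' k, yterm (k + (K + 1)) := yterm_le_tail (K + 1)
    _ ≤ (2 : ℝ) ^ hexp K * ∑' k, yterm (k + (K + 1)) :=
        le_mul_of_one_le_left (yQ_tail_pos _).le (one_le_pow₀ (by norm_num))

/-! ### 6a. The plane lemma -/

/-- The defect `E_K = n · h_K`. -/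
def Edef (n : Fin 3 → ℤ) (K : ℕ) : ℤ := ∑ i, n i * hKvec K i

/-- Expansion of the pairing `E(n, K) = Σ i, n i · (h_K) i`. -/
theorem Edef_eq (n : Fin 3 → ℤ) (K : ℕ) :
    Edef n K = -(n 0 * pmP K) - n 1 * pmM K + n 2 * 2 ^ hexp K := by
  rw [Edef, Fin.sum_univ_three, hKvec_zero, hKvec_one, hKvec_two]; push_cast; ring

/-- The recurrence `E_{K+1} = 2^{a_{K+1} − a_K} E_K − (n₀ if K+1 even, else n₁)`. -/
theorem Edef_succ (n : Fin 3 → ℤ) (K : ℕ) :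
    Edef n (K + 1) = 2 ^ (hexp (K + 1) - hexp K) * Edef n K - (if Even (K + 1) then n 0 else n 1) := by
  rw [Edef_eq, Edef_eq]
  have e2 : (2 : ℤ) ^ hexp (K + 1) = 2 ^ hexp K * 2 ^ (hexp (K + 1) - hexp K) := by
    rw [← pow_add]; congr 1; have := hexp_lt_succ K; omega
  simp only [pmP, pmM]
  rw [e2]
  split_ifs <;> push_cast <;> ring

/-- `2·A ≤ 2^A` for `A ≥ 1`. -/
private theorem two_mul_le_two_pow {A : ℕ} (hA : 1 ≤ A) : 2 * A ≤ 2 ^ A := by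
  induction A, hA using Nat.le_induction with
  | base => norm_num
  | succ A hA ih =>
      have h2 : 2 ≤ 2 ^ A := by
        calc 2 = 2 ^ 1 := by norm_num
          _ ≤ 2 ^ A := Nat.pow_le_pow_right (by norm_num) hA
      rw [pow_succ]; omega

/-- The gaps dominate: `a_K ≤ a_{K+1} − a_K`. -/
theorem hexp_le_gap (K : ℕ) : hexp K ≤ hexp (K + 1) - hexp K := by
  have h : 2 * hexp K ≤ hexp (K + 1) := by
    rw [hexp_succ]
    calc 2 * hexp K ≤ 2 ^ hexp K := two_mul_le_two_pow (one_le_hexp K)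
      _ ≤ 2 ^ ((K + 1) * hexp K) :=
          Nat.pow_le_pow_right (by norm_num) (Nat.le_mul_of_pos_left _ (by omega))
  omega

/-- Propagation of a non-zero defect. -/
theorem Edef_succ_ne_zero {n : Fin 3 → ℤ} {K : ℕ} (hK : (n 0).natAbs + (n 1).natAbs ≤ K)
    (hE : Edef n K ≠ 0) : Edef n (K + 1) ≠ 0 := by
  rw [Edef_succ]
  have hd : K + 1 ≤ hexp (K + 1) - hexp K := (succ_le_hexp K).trans (hexp_le_gap K)
  have h2d : K + 1 ≤ 2 ^ (hexp (K + 1) - hexp K) := hd.trans Nat.lt_two_pow_self.le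
  have hlt : ((n 0).natAbs : ℤ) + (n 1).natAbs < (2 : ℤ) ^ (hexp (K + 1) - hexp K) := by
    have : (n 0).natAbs + (n 1).natAbs < 2 ^ (hexp (K + 1) - hexp K) := by omega
    exact_mod_cast this
  rw [Nat.cast_natAbs, Nat.cast_natAbs, Int.cast_id, Int.cast_id] at hlt
  intro h0
  have hE1 : 1 ≤ |Edef n K| := Int.one_le_abs hE
  have heq : (2 : ℤ) ^ (hexp (K + 1) - hexp K) * Edef n K = if Even (K + 1) then n 0 else n 1 := by
    linarith [h0]
  have habs : |(2 : ℤ) ^ (hexp (K + 1) - hexp K) * Edef n K| ≤ |n 0| + |n 1| := by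
    rw [heq]; split_ifs <;> linarith [abs_nonneg (n 0), abs_nonneg (n 1)]
  rw [abs_mul, abs_of_pos (by positivity : (0 : ℤ) < 2 ^ (hexp (K + 1) - hexp K))] at habs
  have h3 : (2 : ℤ) ^ (hexp (K + 1) - hexp K) ≤ 2 ^ (hexp (K + 1) - hexp K) * |Edef n K| :=
    le_mul_of_one_le_right (by positivity) hE1
  linarith

/-- **THE PLANE LEMMA.**  `n · h_K = 0` at one index `K ≥ |n₀| + |n₁| + 2` forces `n = 0`. -/
theorem eq_zero_of_Edef_eq_zero {n : Fin 3 → ℤ} {K : ℕ} (hK : (n 0).natAbs + (n 1).natAbs + 2 ≤ K)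
    (hE : Edef n K = 0) : n = 0 := by
  obtain ⟨K₁, rfl⟩ : ∃ K₁, K = K₁ + 2 := ⟨K - 2, by omega⟩
  have hE2 : Edef n (K₁ + 1 + 1) = 0 := hE
  have h1 : Edef n (K₁ + 1) = 0 := by
    by_contra h; exact (Edef_succ_ne_zero (by omega) h) hE2
  have h0 : Edef n K₁ = 0 := by
    by_contra h; exact (Edef_succ_ne_zero (by omega) h) h1
  have r1 := Edef_succ n K₁
  have r2 := Edef_succ n (K₁ + 1)
  rw [h1, h0, mul_zero, zero_sub] at r1
  rw [hE2, h1, mul_zero, zero_sub] at r2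
  have hn01 : n 0 = 0 ∧ n 1 = 0 := by
    by_cases hp : Even (K₁ + 1)
    · have hq : ¬ Even (K₁ + 1 + 1) := by rw [Nat.even_add_one]; exact not_not.mpr hp
      rw [if_pos hp] at r1; rw [if_neg hq] at r2; constructor <;> linarith
    · have hq : Even (K₁ + 1 + 1) := by rw [Nat.even_add_one]; exact hp
      rw [if_neg hp] at r1; rw [if_pos hq] at r2; constructor <;> linarith
  have hn2 : n 2 = 0 := by
    have e := Edef_eq n (K₁ + 2)
    rw [hE, hn01.1, hn01.2] at e
    have h2 : (2 : ℤ) ^ hexp (K₁ + 2) ≠ 0 := pow_ne_zero _ (by norm_num)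
    have : n 2 * 2 ^ hexp (K₁ + 2) = 0 := by linarith
    rcases mul_eq_zero.mp this with h3 | h3
    · exact h3
    · exact absurd h3 h2
  funext i
  match i with
  | 0 => exact hn01.1
  | 1 => exact hn01.2
  | 2 => exact hn2

/-! ### 6b. The reduction: an HL pair forces a planted form into a fixed rational plane -/

/-- `2^A ≤ exp A`. -/
private theorem two_pow_le_exp (A : ℕ) : (2 : ℝ) ^ A ≤ Real.exp A := by
  calc (2 : ℝ) ^ A ≤ Real.exp 1 ^ A :=
        pow_le_pow_left₀ (by norm_num) (by have := Real.add_one_le_exp (1 : ℝ); linarith) A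
    _ = Real.exp A := by rw [← Real.exp_nat_mul, mul_one]

/-- **NO HYPER-LIOUVILLE PAIR in the span of `z_Q` (mod LEMMA P).** -/
theorem not_hasHLPairInSpan_yQ_of (hP : SmallFormsArePlanted) : ¬ HasHLPairInSpan (quadTriple 2 yQ) := by
  rintro ⟨v, ρ, hv0, hρ, hv, hρv⟩
  obtain ⟨u, hu⟩ := (Submodule.mem_span_range_iff_exists_fun ℤ).mp hv
  obtain ⟨u', hu'⟩ := (Submodule.mem_span_range_iff_exists_fun ℤ).mp hρv
  simp only [zsmul_eq_mul] at hu hu'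
  have hρirr : Irrational ρ := hρ.irrational
  -- the normal vector n = u × u' is non-zero
  have hu0 : u ≠ 0 := by
    intro h; apply hv0; rw [← hu]; simp [h]
  have hn : cvec u u' ≠ 0 := by
    intro hc
    have h0 : (u 1 : ℂ) * u' 2 - u 2 * u' 1 = 0 := by exact_mod_cast congr_fun hc 0
    have h1 : (u 2 : ℂ) * u' 0 - u 0 * u' 2 = 0 := by exact_mod_cast congr_fun hc 1
    have h2 : (u 0 : ℂ) * u' 1 - u 1 * u' 0 = 0 := by exact_mod_cast congr_fun hc 2
    obtain ⟨k, hk⟩ := Function.ne_iff.mp hu0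
    have hu3 := hu
    have hu3' := hu'
    rw [Fin.sum_univ_three] at hu3 hu3'
    have hpar : ∀ k : Fin 3, (u k : ℂ) * ((ρ : ℂ) * v) = (u' k : ℂ) * v := by
      intro k
      rw [← hu3', ← hu3]
      match k with
      | 0 => linear_combination (quadTriple 2 yQ 1) * h2 - (quadTriple 2 yQ 2) * h1
      | 1 => linear_combination (-(quadTriple 2 yQ 0)) * h2 + (quadTriple 2 yQ 2) * h0
      | 2 => linear_combination (quadTriple 2 yQ 0) * h1 - (quadTriple 2 yQ 1) * h0
    have hkC : (u k : ℂ) ≠ 0 := by exact_mod_cast hk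
    have hρC : (ρ : ℂ) = (u' k : ℂ) / (u k : ℂ) := by
      rw [eq_div_iff hkC]
      have := hpar k
      have h3 : ((u k : ℂ) * (ρ : ℂ) - (u' k : ℂ)) * v = 0 := by linear_combination this
      rcases mul_eq_zero.mp h3 with h4 | h4
      · linear_combination h4
      · exact absurd h4 hv0
    apply hρirr
    refine ⟨(u' k : ℚ) / (u k : ℚ), ?_⟩
    have : ((((u' k : ℚ) / (u k : ℚ) : ℚ) : ℝ) : ℂ) = (ρ : ℂ) := by rw [hρC]; push_cast; rfl
    exact_mod_cast this
  -- LEMMA P with exponent e = m₀ + 1 ≥ 1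
  obtain ⟨m₀, hm₀⟩ := hP
  set e : ℕ := m₀ + 1 with he
  -- constants
  have hvpos : 0 < ‖v‖ := norm_pos_iff.mpr hv0
  set Nu : ℝ := ∑ i, |(u i : ℝ)| with hNu
  set Nu' : ℝ := ∑ i, |(u' i : ℝ)| with hNu'
  have hNu0 : 0 ≤ Nu := Finset.sum_nonneg fun _ _ => abs_nonneg _
  have hNu'0 : 0 ≤ Nu' := Finset.sum_nonneg fun _ _ => abs_nonneg _
  set c : ℝ := 1 + (|ρ| + 1) * Nu + Nu' with hc
  have hc1 : 1 ≤ c := by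
    have : 0 ≤ (|ρ| + 1) * Nu + Nu' := by positivity
    rw [hc]; linarith only [this]
  set B : ℕ := (cvec u u' 0).natAbs + (cvec u u' 1).natAbs + 2 with hB
  obtain ⟨L, hL⟩ := exists_nat_ge (‖v‖ + c ^ e + hexp B + 1)
  -- a good approximation p/q of ρ at level max (e+1) L
  obtain ⟨r, hden, hne, hlt⟩ := hρ (max (e + 1) L)
  have hq1 : 1 ≤ r.den := r.den_pos
  have hqR1 : (1 : ℝ) ≤ r.den := by exact_mod_cast hq1
  have hqR0 : (0 : ℝ) < r.den := by linarith
  have hqe : e + 1 ≤ r.den := le_trans (le_max_left _ _) hden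
  have hqL : (‖v‖ + c ^ e + hexp B + 1 : ℝ) ≤ r.den :=
    hL.trans (by exact_mod_cast le_trans (le_max_right _ _) hden)
  -- the form p u − q u'
  set w : Fin 3 → ℤ := fun i => r.num * u i - r.den * u' i with hw
  have hnum : ((r.num : ℤ) : ℂ) = (r : ℂ) * (r.den : ℂ) := by
    have h1 : ((r * r.den : ℚ) : ℂ) = ((r.num : ℚ) : ℂ) := by rw [Rat.mul_den_eq_num]
    push_cast at h1
    rw [← h1]
  have hform : ∑ i, (w i : ℂ) * quadTriple 2 yQ i =
      (r.den : ℂ) * ((((r : ℝ) - ρ : ℝ)) : ℂ) * v := by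
    have e1 : ∑ i, (w i : ℂ) * quadTriple 2 yQ i =
        (r.num : ℂ) * ∑ i, (u i : ℂ) * quadTriple 2 yQ i -
          (r.den : ℂ) * ∑ i, (u' i : ℂ) * quadTriple 2 yQ i := by
      rw [Finset.mul_sum, Finset.mul_sum, ← Finset.sum_sub_distrib]
      refine Finset.sum_congr rfl fun i _ => ?_
      simp only [hw]; push_cast; ring
    rw [e1, hu, hu', hnum]; push_cast; ring
  have hnorm : ‖∑ i, (w i : ℂ) * quadTriple 2 yQ i‖ = (r.den : ℝ) * |ρ - r| * ‖v‖ := by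
    rw [hform, norm_mul, norm_mul, Complex.norm_natCast, Complex.norm_real, Real.norm_eq_abs,
      abs_sub_comm]
  have hw0 : w ≠ 0 := by
    intro h0
    have : (r.den : ℝ) * |ρ - r| * ‖v‖ = 0 := by rw [← hnorm, h0]; simp
    rcases mul_eq_zero.mp this with h1 | h1
    · rcases mul_eq_zero.mp h1 with h2 | h2
      · exact hqR0.ne' h2
      · exact hne (sub_eq_zero.mp (abs_eq_zero.mp h2))
    · exact hvpos.ne' h1
  -- height of the form: 1 + |w|₁ ≤ c q
  have hp_le : |(r.num : ℝ)| ≤ (|ρ| + 1) * r.den := by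
    have h1 : |ρ - r| < 1 := hlt.trans_le (by
      rw [Real.exp_le_one_iff]; exact neg_nonpos.mpr (by positivity))
    have h2 : |(r : ℝ)| ≤ |ρ| + 1 := by
      have := abs_sub_abs_le_abs_sub (r : ℝ) ρ; rw [abs_sub_comm] at this; linarith
    have h3 : (r : ℝ) * r.den = r.num := ratCast_mul_den r
    rw [← h3, abs_mul, Nat.abs_cast]
    exact mul_le_mul_of_nonneg_right h2 hqR0.le
  have hW : 1 + ∑ i, |(w i : ℝ)| ≤ c * r.den := by
    have h1 : ∑ i, |(w i : ℝ)| ≤ |(r.num : ℝ)| * Nu + (r.den : ℝ) * Nu' := by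
      rw [hNu, hNu', Finset.mul_sum, Finset.mul_sum, ← Finset.sum_add_distrib]
      refine Finset.sum_le_sum fun i _ => ?_
      simp only [hw]; push_cast
      calc |(r.num : ℝ) * u i - r.den * u' i| ≤ |(r.num : ℝ) * u i| + |(r.den : ℝ) * u' i| :=
            abs_sub _ _
        _ = |(r.num : ℝ)| * |(u i : ℝ)| + (r.den : ℝ) * |(u' i : ℝ)| := by
            rw [abs_mul, abs_mul, Nat.abs_cast]
    have h2 : |(r.num : ℝ)| * Nu ≤ (|ρ| + 1) * r.den * Nu := mul_le_mul_of_nonneg_right hp_le hNu0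
    calc 1 + ∑ i, |(w i : ℝ)| ≤ 1 + ((|ρ| + 1) * r.den * Nu + (r.den : ℝ) * Nu') := by
          linarith only [h1, h2]
      _ ≤ r.den + ((|ρ| + 1) * r.den * Nu + (r.den : ℝ) * Nu') := by linarith only [hqR1]
      _ = c * r.den := by rw [hc]; ring
  -- smallness: ‖form‖ < exp(−((c q)^e + a_B))
  have hsmall : ‖∑ i, (w i : ℂ) * quadTriple 2 yQ i‖ <
      Real.exp (-((c * r.den) ^ e + hexp B)) := by
    rw [hnorm]
    have h1 : (r.den : ℝ) * |ρ - r| * ‖v‖ < (r.den : ℝ) * ‖v‖ * Real.exp (-((r.den : ℝ) ^ max (e + 1) L)) := by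
      have := mul_lt_mul_of_pos_left hlt (mul_pos hqR0 hvpos)
      calc (r.den : ℝ) * |ρ - r| * ‖v‖ = (r.den : ℝ) * ‖v‖ * |ρ - r| := by ring
        _ < (r.den : ℝ) * ‖v‖ * Real.exp (-((r.den : ℝ) ^ max (e + 1) L)) := this
    refine h1.trans_le ?_
    have hqv : 0 < (r.den : ℝ) * ‖v‖ := mul_pos hqR0 hvpos
    rw [← Real.exp_log hqv, ← Real.exp_add]
    apply Real.exp_le_exp.mpr
    have hlog : Real.log ((r.den : ℝ) * ‖v‖) ≤ (r.den : ℝ) * ‖v‖ - 1 := Real.log_le_sub_one_of_pos hqv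
    -- q^(max) ≥ q^(e+1) = q^e q ≥ q^e (‖v‖ + c^e + a_B + 1)
    have hpow1 : (r.den : ℝ) ^ (e + 1) ≤ (r.den : ℝ) ^ max (e + 1) L :=
      pow_le_pow_right₀ hqR1 (le_max_left _ _)
    have hqe1 : (r.den : ℝ) ≤ (r.den : ℝ) ^ e := by
      calc (r.den : ℝ) = (r.den : ℝ) ^ 1 := (pow_one _).symm
        _ ≤ (r.den : ℝ) ^ e := pow_le_pow_right₀ hqR1 (by omega)
    have hqe0 : (1 : ℝ) ≤ (r.den : ℝ) ^ e := one_le_pow₀ hqR1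
    have h2 : (r.den : ℝ) ^ e * (‖v‖ + c ^ e + hexp B + 1) ≤ (r.den : ℝ) ^ (e + 1) := by
      rw [pow_succ]; exact mul_le_mul_of_nonneg_left hqL (by positivity)
    have h3 : (r.den : ℝ) * ‖v‖ ≤ (r.den : ℝ) ^ e * ‖v‖ := mul_le_mul_of_nonneg_right hqe1 hvpos.le
    have h4 : (c * r.den) ^ e = c ^ e * (r.den : ℝ) ^ e := mul_pow _ _ _
    have h5 : (hexp B : ℝ) ≤ (r.den : ℝ) ^ e * hexp B :=
      le_mul_of_one_le_left (Nat.cast_nonneg _) hqe0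
    have h6 : (r.den : ℝ) ^ e * (‖v‖ + c ^ e + hexp B + 1) =
        (r.den : ℝ) ^ e * ‖v‖ + c ^ e * (r.den : ℝ) ^ e + (r.den : ℝ) ^ e * hexp B + (r.den : ℝ) ^ e := by
      ring
    linarith only [hlog, hpow1, h2, h3, h4, h5, h6, hqe0]
  -- apply LEMMA P
  have hWe : (1 + ∑ i, |(w i : ℝ)|) ^ m₀ ≤ (c * r.den) ^ e + hexp B := by
    have hW1 : 1 ≤ 1 + ∑ i, |(w i : ℝ)| := by
      have : 0 ≤ ∑ i, |(w i : ℝ)| := Finset.sum_nonneg fun _ _ => abs_nonneg _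
      linarith only [this]
    calc (1 + ∑ i, |(w i : ℝ)|) ^ m₀ ≤ (1 + ∑ i, |(w i : ℝ)|) ^ e := pow_le_pow_right₀ hW1 (by omega)
      _ ≤ (c * r.den) ^ e := pow_le_pow_left₀ (by linarith only [hW1]) hW e
      _ ≤ (c * r.den) ^ e + hexp B := by linarith only [Nat.cast_nonneg (α := ℝ) (hexp B)]
  obtain ⟨K, t, hKt⟩ := hm₀ w hw0 (hsmall.trans_le (Real.exp_le_exp.mpr (neg_le_neg hWe)))
  have ht : t ≠ 0 := by rintro rfl; exact hw0 (by rw [hKt]; simp)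
  -- K ≥ B
  have hKB : B ≤ K := by
    by_contra hlt'
    have hle : hexp (K + 1) ≤ hexp B := hexp_strictMono.monotone (by omega)
    have h1 : 1 / (2 : ℝ) ^ hexp B ≤ ‖∑ i, (w i : ℂ) * quadTriple 2 yQ i‖ := by
      calc 1 / (2 : ℝ) ^ hexp B ≤ 1 / (2 : ℝ) ^ hexp (K + 1) :=
            one_div_le_one_div_of_le (by positivity) (pow_le_pow_right₀ (by norm_num) hle)
        _ ≤ ‖∑ i, (hKvec K i : ℂ) * quadTriple 2 yQ i‖ := hKvec_form_lower K
        _ ≤ |(t : ℝ)| * ‖∑ i, (hKvec K i : ℂ) * quadTriple 2 yQ i‖ := by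
            apply le_mul_of_one_le_left (norm_nonneg _)
            rw [← Int.cast_abs]; exact_mod_cast Int.one_le_abs ht
        _ = ‖∑ i, (w i : ℂ) * quadTriple 2 yQ i‖ := by
            rw [hKt, ← Complex.norm_intCast, ← norm_mul, Finset.mul_sum]
            congr 1
            refine Finset.sum_congr rfl fun i _ => ?_
            simp only [Pi.smul_apply, smul_eq_mul, Int.cast_mul]; ring
    have h2 : ‖∑ i, (w i : ℂ) * quadTriple 2 yQ i‖ < 1 / (2 : ℝ) ^ hexp B := by
      calc ‖∑ i, (w i : ℂ) * quadTriple 2 yQ i‖ < Real.exp (-((c * r.den) ^ e + hexp B)) := hsmall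
        _ ≤ Real.exp (-(hexp B : ℝ)) := Real.exp_le_exp.mpr (by
            linarith only [pow_nonneg (mul_nonneg (by linarith only [hc1]) hqR0.le : (0:ℝ) ≤ c * r.den) e])
        _ ≤ 1 / (2 : ℝ) ^ hexp B := by
            rw [Real.exp_neg, ← one_div]
            exact one_div_le_one_div_of_le (by positivity) (two_pow_le_exp _)
    linarith only [h1, h2]
  -- n · h_K = 0
  have hE : Edef (cvec u u') K = 0 := by
    have e1 : ∑ i, cvec u u' i * w i = 0 := by
      simp only [hw, Fin.sum_univ_three, cvec_zero, cvec_one, cvec_two]; ring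
    rw [hKt] at e1
    have e2 : ∑ i, cvec u u' i * (t • hKvec K) i = t * Edef (cvec u u') K := by
      rw [Edef, Finset.mul_sum]
      refine Finset.sum_congr rfl fun i _ => ?_
      simp only [Pi.smul_apply, smul_eq_mul]; ring
    rw [e2] at e1
    rcases mul_eq_zero.mp e1 with h1 | h1
    · exact absurd h1 ht
    · exact h1
  exact hn (eq_zero_of_Edef_eq_zero (by rw [hB] at hKB; exact hKB) hE)

end HyperCell

end Summit.Schanuel.Schanuel.Theorems.RootDecomp1KHyper
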